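import Summits.QuantumAdvantage.QuantumAdvantage.Theorems.WalkFiniteStateRungEquidist

/-!
# Rung (G) `Coset21.TwoStepFiniteStateWalkHard 5` — part 3/6 — §4 composition `twoStepFiniteStateWalkHard_of`, §5–§6 dense-regime tools (operator-product norms, transfer identity)

VERBATIM split (for the 400-line rule) of planner qa-qnc0-p2 g22's `HOME/qa-qnc0-p2/line22/RungGCore.lean` v3 (sha16 `70defc48ef50f6ad`;
authored AND proved by the planner seat; landed by qn-prover-3 g14, ask P2-22d, `--supports stmt-QuantumAdvantage-28072`).
(+ one-line docstrings on undocumented auxiliaries, lint.)  See `WalkFiniteStateRungContraction.lean` for the planner's docstring.  WHAT THIS IS NOT: nothing about polynomial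
strategies or `LinSel`; separation NOT moved.  (Part 3: the planner's `wtPrefix_zero_rg` is replaced by the tree's
identical `AffBells… wtPrefix_zero` of `WindowLadderBlocks.lean` — gate dedup.)
-/

noncomputable section

namespace Summit.QuantumAdvantage.AdviceFreeQNC0

namespace Coset21

namespace RungG

open Finset

variable {M : ℕ}

/-! ## §4 Composition -/


/-- Auxiliary step `walkHard_of_bounds` of rung (G) (planner qa-qnc0-p2, `RungGCore.lean` v3, verbatim). -/
theorem walkHard_of_bounds (p : ℕ) [Fact p.Prime] (hS : SparseBound p) (hD : DenseBound p) :
    TwoStepFiniteStateWalkHard p := by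
  haveI : NeZero p := ⟨(Fact.out : p.Prime).ne_zero⟩
  intro ε hε
  obtain ⟨m, hm, hSm⟩ := hS (ε / 2) (by linarith)
  obtain ⟨κ, hκ0, hκ1, hDκ⟩ := hD
  have h1κ : 0 ≤ 1 - κ := by linarith
  have h1κ' : 1 - κ < 1 := by linarith
  have hp0 : (0 : ℝ) ≤ p := Nat.cast_nonneg p
  have h3p : (0 : ℝ) < 3 * p + 1 := by positivity
  obtain ⟨k₀, hk₀⟩ : ∃ k₀ : ℕ, (1 - κ) ^ k₀ < ε / (3 * p + 1) :=
    exists_pow_lt_of_lt_one (div_pos hε h3p) h1κ'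
  refine ⟨m * (2 * k₀ + 2), fun n hn c y hy => ?_⟩
  obtain ⟨T, hT⟩ := hy
  have hyT : y = yOf T := funext fun g => funext fun u => hT g u
  subst hyT
  -- fiberwise decomposition over the endpoint class `wt u (mod p)`
  have hwinN : (univ.filter fun u : Fin n → Bool => ringWinU c (yOf T) u = true).card
      = ∑ w : ZMod p, (winIn c T w).card :=
    Finset.card_eq_sum_card_fiberwise (f := fun u : Fin n → Bool => ((wt u : ℕ) : ZMod p))
      (fun _ _ => Finset.mem_univ _)
  have hclsN : (univ : Finset (Fin n → Bool)).card = ∑ w : ZMod p, (classOf p w : Finset (Fin n → Bool)).card :=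
    Finset.card_eq_sum_card_fiberwise (f := fun u : Fin n → Bool => ((wt u : ℕ) : ZMod p))
      (fun _ _ => Finset.mem_univ _)
  have h2n : ((univ : Finset (Fin n → Bool)).card : ℝ) = (2 : ℝ) ^ n := by
    rw [Finset.card_univ, Fintype.card_fun, Fintype.card_bool, Fintype.card_fin]
    push_cast
    rfl
  have hwin : ((univ.filter fun u : Fin n → Bool => ringWinU c (yOf T) u = true).card : ℝ)
      = ∑ w : ZMod p, ((winIn c T w).card : ℝ) := by
    exact_mod_cast hwinN
  have hcls : ∑ w : ZMod p, ((classOf p w : Finset (Fin n → Bool)).card : ℝ) = (2 : ℝ) ^ n := by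
    rw [← h2n]
    exact_mod_cast hclsN.symm
  have hpos2 : (0 : ℝ) < (2 : ℝ) ^ n := by positivity
  have hE0 : (0 : ℝ) ≤ 3 / 2 * (2 : ℝ) ^ n * (1 - κ) ^ k₀ := by positivity
  -- per-class bound
  have hper : ∀ w : ZMod p, ((winIn c T w).card : ℝ)
      ≤ (2 / 3 + ε / 2) * ((classOf p w : Finset (Fin n → Bool)).card : ℝ) + 3 / 2 * (2 : ℝ) ^ n * (1 - κ) ^ k₀ := by
    intro w
    by_cases hsp : (activeCount T w + 1) * m ≤ n
    · have h := hSm n c T w hsp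
      linarith
    · have hd := hDκ n c T w
      push Not at hsp
      have h1 : m * (2 * k₀ + 2) < (activeCount T w + 1) * m := lt_of_le_of_lt hn hsp
      rw [Nat.mul_comm m] at h1
      have h2 : 2 * k₀ + 2 < activeCount T w + 1 := Nat.lt_of_mul_lt_mul_right h1
      have hN : k₀ ≤ activeCount T w / 2 - 1 := by omega
      have hpow : (1 - κ) ^ (activeCount T w / 2 - 1) ≤ (1 - κ) ^ k₀ := pow_le_pow_of_le_one h1κ h1κ'.le hN
      have hc0 : (0 : ℝ) ≤ ((classOf p w : Finset (Fin n → Bool)).card : ℝ) := Nat.cast_nonneg _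
      have hcl : ((classOf p w : Finset (Fin n → Bool)).card : ℝ) / 2
          ≤ (2 / 3 + ε / 2) * ((classOf p w : Finset (Fin n → Bool)).card : ℝ) := by
        nlinarith
      have h32 : (0 : ℝ) ≤ 3 / 2 * (2 : ℝ) ^ n := by positivity
      linarith [(abs_le.mp hd).2, mul_le_mul_of_nonneg_left hpow h32]
  -- error budget
  have hq : (p : ℝ) * (3 / 2 * (2 : ℝ) ^ n * (1 - κ) ^ k₀) ≤ ε / 2 * (2 : ℝ) ^ n := by
    have hq0 : 0 ≤ (1 - κ) ^ k₀ := pow_nonneg h1κ k₀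
    have hk' : (1 - κ) ^ k₀ * (3 * p + 1) ≤ ε := by
      have := hk₀.le
      rwa [le_div_iff₀ h3p] at this
    have h' : (p : ℝ) * (3 / 2) * (1 - κ) ^ k₀ ≤ ε / 2 := by nlinarith
    calc (p : ℝ) * (3 / 2 * (2 : ℝ) ^ n * (1 - κ) ^ k₀) = ((p : ℝ) * (3 / 2) * (1 - κ) ^ k₀) * (2 : ℝ) ^ n := by ring
      _ ≤ ε / 2 * (2 : ℝ) ^ n := mul_le_mul_of_nonneg_right h' hpos2.le
  -- sum over the classes
  calc ((univ.filter fun u : Fin n → Bool => ringWinU c (yOf T) u = true).card : ℝ)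
      = ∑ w : ZMod p, ((winIn c T w).card : ℝ) := hwin
    _ ≤ ∑ w : ZMod p, ((2 / 3 + ε / 2) * ((classOf p w : Finset (Fin n → Bool)).card : ℝ)
          + 3 / 2 * (2 : ℝ) ^ n * (1 - κ) ^ k₀) := Finset.sum_le_sum fun w _ => hper w
    _ = (2 / 3 + ε / 2) * (2 : ℝ) ^ n + (p : ℝ) * (3 / 2 * (2 : ℝ) ^ n * (1 - κ) ^ k₀) := by
          rw [Finset.sum_add_distrib, ← Finset.mul_sum, hcls, Finset.sum_const, Finset.card_univ, ZMod.card p, nsmul_eq_mul]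
    _ ≤ (2 / 3 + ε) * (2 : ℝ) ^ n := by linarith [hq]

/-- **Composition**: the four stubs give the rung for every prime `p ≥ 5`. -/
theorem twoStepFiniteStateWalkHard_of (p : ℕ) [Fact p.Prime]
    (h₁ : Equidist) (h₂ : Equidist → SparseBound p) (h₃ : Contraction) (h₄ : Contraction → DenseBound p) :
    TwoStepFiniteStateWalkHard p :=
  walkHard_of_bounds p (h₂ h₁) (h₄ h₃)

/-- The rung at `p = 5`, CONDITIONAL on the two outstanding lemmas (`stub_sparse 5 le_rfl`, `stub_dense 5 le_rfl` of the
skeleton); `Equidist` and `Contraction` are supplied by §3 and §2. -/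
theorem twoStepFiniteStateWalkHard_five_of (hS : Equidist → SparseBound 5) (hD : Contraction → DenseBound 5) :
    TwoStepFiniteStateWalkHard 5 :=
  haveI : Fact (Nat.Prime 5) := ⟨by norm_num⟩
  twoStepFiniteStateWalkHard_of 5 stub_equidist hS stub_contraction hD


/-! ## §5 Dense-regime TOOL (planner qa-qnc0-p2 g22): norm bookkeeping for the operator product `D₀ P D₁ P ⋯ P D_m acc`

Generic, sorry-free.  `prodOp [D₀, …, D_{m-1}] acc = D₀ P (D₁ P (⋯ (D_{m-1} P acc)))` (`P = lazyStep`, `D = signFlip D`).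
`oddTagged` counts the `true` TAGS at odd positions `1, 3, 5, …` of the tag list `L.map Prod.snd` (tag = "certified non-constant");
`oddTagged_add_oddTagged_cons`: the odd pairing of `l` and of `b :: l` together see every tag of `l` (so one of the two pairings sees half).
`sumSq_prodOp_le`: with the `Contraction` constant `κ` for modulus `M+1`,
`∑ (prodOp (L.map fst) acc)² ≤ ((1-κ)²)^(oddTagged (L.map snd)) · ∑ acc²` — pair the list as `D₀ (P D₁ P) D₂ (P D₃ P) …`; each sandwiched tagged
pattern contracts by `(1-κ)²`, everything else is a weak contraction.  The prover of `stub_dense` applies it to the list of the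
cut patterns `g = 0, …, n-1` with `acc = D_n 𝟙_{w'}` (and to its tail for the even pairing), after the transfer identity
`Σ_u (−1)^{count u} 𝟙[x_n u = w'] = 2^n · (prodOp … ) 0`; `sq_apply_le_sumSq` turns the `ℓ²` bound into the pointwise one. -/

/-- `D₀ P D₁ P ⋯ D_{m-1} P acc`. -/
noncomputable def prodOp {M : ℕ} : List (ZMod (M + 1) → Bool) → (ZMod (M + 1) → ℝ) → (ZMod (M + 1) → ℝ)
  | [], acc => acc
  | D :: L, acc => signFlip D (lazyStep (prodOp L acc))

/-- Number of `true` tags at odd positions `1, 3, 5, …` of a tag list. -/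
def oddTagged : List Bool → ℕ
  | [] => 0
  | [_] => 0
  | _ :: b :: l => b.toNat + oddTagged l

/-- Number of `true` tags. -/
def tagCount : List Bool → ℕ
  | [] => 0
  | b :: l => b.toNat + tagCount l

/-- Odd positions of `l` and odd positions of `b :: l` (= even positions of `l`) together cover `l`. -/
theorem oddTagged_add_oddTagged_cons (b : Bool) : ∀ l : List Bool, oddTagged l + oddTagged (b :: l) = tagCount l
  | [] => by simp [oddTagged, tagCount]
  | [b₂] => by simp [oddTagged, tagCount]
  | b₂ :: b₃ :: l => by
      have ih := oddTagged_add_oddTagged_cons b₃ l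
      simp only [oddTagged, tagCount] at ih ⊢
      omega

/-- Auxiliary step `tagCount_ofFn` of rung (G) (planner qa-qnc0-p2, `RungGCore.lean` v3, verbatim). -/
theorem tagCount_ofFn : ∀ (n : ℕ) (f : Fin n → Bool), tagCount (List.ofFn f) = ∑ i : Fin n, (f i).toNat
  | 0, f => by simp [tagCount]
  | n + 1, f => by
      rw [List.ofFn_succ, Fin.sum_univ_succ]
      simp only [tagCount]
      rw [tagCount_ofFn n]

/-- Auxiliary step `prodOp_nil` of rung (G) (planner qa-qnc0-p2, `RungGCore.lean` v3, verbatim). -/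
theorem prodOp_nil {M : ℕ} (acc : ZMod (M + 1) → ℝ) : prodOp [] acc = acc := rfl

/-- Auxiliary step `prodOp_cons` of rung (G) (planner qa-qnc0-p2, `RungGCore.lean` v3, verbatim). -/
theorem prodOp_cons {M : ℕ} (D : ZMod (M + 1) → Bool) (L : List (ZMod (M + 1) → Bool)) (acc : ZMod (M + 1) → ℝ) :
    prodOp (D :: L) acc = signFlip D (lazyStep (prodOp L acc)) := rfl

/-- Auxiliary step `sumSq_lazyStep_le` of rung (G) (planner qa-qnc0-p2, `RungGCore.lean` v3, verbatim). -/
theorem sumSq_lazyStep_le {M : ℕ} (v : ZMod (M + 1) → ℝ) : ∑ x, (lazyStep v x) ^ 2 ≤ ∑ x, (v x) ^ 2 := by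
  rw [sum_lazyStep_sq]
  have := grad_nonneg v
  linarith

/-- Auxiliary step `sumSq_step_le` of rung (G) (planner qa-qnc0-p2, `RungGCore.lean` v3, verbatim). -/
theorem sumSq_step_le {M : ℕ} (D : ZMod (M + 1) → Bool) (v : ZMod (M + 1) → ℝ) :
    ∑ x, (signFlip D (lazyStep v) x) ^ 2 ≤ ∑ x, (v x) ^ 2 := by
  rw [sum_signFlip_sq]
  exact sumSq_lazyStep_le v

/-- Auxiliary step `sumSq_nonneg` of rung (G) (planner qa-qnc0-p2, `RungGCore.lean` v3, verbatim). -/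
theorem sumSq_nonneg {M : ℕ} (v : ZMod (M + 1) → ℝ) : 0 ≤ ∑ x, (v x) ^ 2 :=
  Finset.sum_nonneg fun x _ => sq_nonneg (v x)

/-- A single coordinate is bounded by the `ℓ²` mass. -/
theorem sq_apply_le_sumSq {M : ℕ} (v : ZMod (M + 1) → ℝ) (x : ZMod (M + 1)) : (v x) ^ 2 ≤ ∑ y, (v y) ^ 2 :=
  Finset.single_le_sum (f := fun y => (v y) ^ 2) (fun y _ => sq_nonneg (v y)) (Finset.mem_univ x)

/-- **The norm bookkeeping.**  `hC` is the `Contraction` property at modulus `M+1` with constant `κ`; every TAGGED pattern of `L` is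
non-constant (`hL`); then the product operator contracts by `(1-κ)²` per tagged pattern at an odd position. -/
theorem sumSq_prodOp_le {M : ℕ} (κ : ℝ) (hκ₀ : 0 ≤ κ) (hκ₁ : κ ≤ 1)
    (hC : ∀ D : ZMod (M + 1) → Bool, (∃ x y, D x ≠ D y) →
      ∀ v : ZMod (M + 1) → ℝ, ∑ x, (lazyStep (signFlip D (lazyStep v)) x) ^ 2 ≤ (1 - κ) ^ 2 * ∑ x, (v x) ^ 2) :
    ∀ (L : List ((ZMod (M + 1) → Bool) × Bool)), (∀ q ∈ L, q.2 = true → ∃ x y, q.1 x ≠ q.1 y) →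
      ∀ acc : ZMod (M + 1) → ℝ,
        ∑ x, (prodOp (L.map Prod.fst) acc x) ^ 2 ≤ ((1 - κ) ^ 2) ^ (oddTagged (L.map Prod.snd)) * ∑ x, (acc x) ^ 2
  | [], _, acc => by simp [prodOp, oddTagged]
  | [q], _, acc => by
      simp only [List.map_cons, List.map_nil, oddTagged, pow_zero, one_mul, prodOp_cons, prodOp_nil]
      exact sumSq_step_le q.1 acc
  | q₀ :: q₁ :: L, hL, acc => by
      have hL' : ∀ q ∈ L, q.2 = true → ∃ x y, q.1 x ≠ q.1 y := fun q hq => hL q (by simp [hq])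
      have ih := sumSq_prodOp_le κ hκ₀ hκ₁ hC L hL' acc
      have h01 : 0 ≤ (1 - κ) ^ 2 := sq_nonneg _
      have hle1 : (1 - κ) ^ 2 ≤ 1 := by nlinarith
      simp only [List.map_cons, prodOp_cons, oddTagged]
      rw [sum_signFlip_sq]
      -- exponent: `q₁.2.toNat + oddTagged (L.map Prod.snd)`
      -- goal: ∑ (lazyStep (signFlip q₁.1 (lazyStep (prodOp (L.map fst) acc))))² ≤ ((1-κ)²)^((if q₁.2 then 1 else 0) + oddTagged L) · ∑ acc²
      set R := prodOp (L.map Prod.fst) acc with hR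
      have hRnn : 0 ≤ ∑ x, (R x) ^ 2 := sumSq_nonneg R
      by_cases h : q₁.2 = true
      · have hnc : ∃ x y, q₁.1 x ≠ q₁.1 y := hL q₁ (by simp) h
        have hc := hC q₁.1 hnc R
        simp only [h, Bool.toNat_true, pow_add, pow_one]
        calc ∑ x, (lazyStep (signFlip q₁.1 (lazyStep R)) x) ^ 2 ≤ (1 - κ) ^ 2 * ∑ x, (R x) ^ 2 := hc
          _ ≤ (1 - κ) ^ 2 * (((1 - κ) ^ 2) ^ oddTagged (L.map Prod.snd) * ∑ x, (acc x) ^ 2) :=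
              mul_le_mul_of_nonneg_left ih h01
          _ = (1 - κ) ^ 2 * ((1 - κ) ^ 2) ^ oddTagged (L.map Prod.snd) * ∑ x, (acc x) ^ 2 := by ring
      · have h0 : q₁.2.toNat + oddTagged (L.map Prod.snd) = oddTagged (L.map Prod.snd) := by simp [eq_false_of_ne_true h]
        rw [h0]
        calc ∑ x, (lazyStep (signFlip q₁.1 (lazyStep R)) x) ^ 2 ≤ ∑ x, (signFlip q₁.1 (lazyStep R) x) ^ 2 :=
              sumSq_lazyStep_le _
          _ ≤ ∑ x, (R x) ^ 2 := sumSq_step_le q₁.1 R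
          _ ≤ ((1 - κ) ^ 2) ^ oddTagged (L.map Prod.snd) * ∑ x, (acc x) ^ 2 := ih

/-- The same bound from `Contraction` packaged: for every modulus there is `κ ∈ (0,1]` with the bookkeeping inequality. -/
theorem exists_kappa_prodOp (hCon : Contraction) (M : ℕ) :
    ∃ κ : ℝ, 0 < κ ∧ κ ≤ 1 ∧ ∀ (L : List ((ZMod (M + 1) → Bool) × Bool)),
      (∀ q ∈ L, q.2 = true → ∃ x y, q.1 x ≠ q.1 y) → ∀ acc : ZMod (M + 1) → ℝ,
        ∑ x, (prodOp (L.map Prod.fst) acc x) ^ 2 ≤ ((1 - κ) ^ 2) ^ (oddTagged (L.map Prod.snd)) * ∑ x, (acc x) ^ 2 := by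
  obtain ⟨κ, hκ₀, hκ₁, hC⟩ := hCon M
  exact ⟨κ, hκ₀, hκ₁, fun L hL acc => sumSq_prodOp_le κ hκ₀.le hκ₁ hC L hL acc⟩

/-- Pointwise corollary: `|(prodOp L acc) x| ≤ (1-κ)^(oddTagged L) · √(∑ acc²)`. -/
theorem abs_prodOp_apply_le {M : ℕ} (κ : ℝ) (hκ₀ : 0 ≤ κ) (hκ₁ : κ ≤ 1)
    (hC : ∀ D : ZMod (M + 1) → Bool, (∃ x y, D x ≠ D y) →
      ∀ v : ZMod (M + 1) → ℝ, ∑ x, (lazyStep (signFlip D (lazyStep v)) x) ^ 2 ≤ (1 - κ) ^ 2 * ∑ x, (v x) ^ 2)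
    (L : List ((ZMod (M + 1) → Bool) × Bool)) (hL : ∀ q ∈ L, q.2 = true → ∃ x y, q.1 x ≠ q.1 y)
    (acc : ZMod (M + 1) → ℝ) (x : ZMod (M + 1)) :
    |prodOp (L.map Prod.fst) acc x| ≤ (1 - κ) ^ (oddTagged (L.map Prod.snd)) * Real.sqrt (∑ y, (acc y) ^ 2) := by
  have h := sumSq_prodOp_le κ hκ₀ hκ₁ hC L hL acc
  have h1 : 0 ≤ 1 - κ := by linarith
  have hsq : (prodOp (L.map Prod.fst) acc x) ^ 2 ≤ ((1 - κ) ^ oddTagged (L.map Prod.snd) * Real.sqrt (∑ y, (acc y) ^ 2)) ^ 2 := by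
    calc (prodOp (L.map Prod.fst) acc x) ^ 2 ≤ ∑ y, (prodOp (L.map Prod.fst) acc y) ^ 2 := sq_apply_le_sumSq _ x
      _ ≤ ((1 - κ) ^ 2) ^ (oddTagged (L.map Prod.snd)) * ∑ y, (acc y) ^ 2 := h
      _ = ((1 - κ) ^ oddTagged (L.map Prod.snd) * Real.sqrt (∑ y, (acc y) ^ 2)) ^ 2 := by
          rw [mul_pow, Real.sq_sqrt (sumSq_nonneg acc), ← pow_mul, ← pow_mul, mul_comm 2]
  have hnn : 0 ≤ (1 - κ) ^ oddTagged (L.map Prod.snd) * Real.sqrt (∑ y, (acc y) ^ 2) :=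
    mul_nonneg (pow_nonneg h1 _) (Real.sqrt_nonneg _)
  exact abs_le_of_sq_le_sq' hsq hnn |>.elim (fun hlo hhi => abs_le.mpr ⟨hlo, hhi⟩)

/-! ## §6 Dense-regime TOOL (planner qa-qnc0-p2 g22): the transfer identity

`sgn D x = ±1` is the sign of the pattern `D` at `x` (`signFlip D v x = sgn D x * v x`).  For cut patterns
`s : Fin (n+1) → (ZMod (M+1) → Bool)`, a final weight `φ` and a start point `x₀`, summing over the cube the signed product along the
lazy path `x_g = x₀ + wtPrefix u g` gives the operator product:
`Σ_u (∏_g sgn (s g) (x₀ + wtPrefix u g)) · φ (x₀ + wt u) = 2^n · prodOp [s 0, …, s (n-1)] (signFlip (s n) φ) x₀`.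
(For `stub_dense`: `M+1 = 3p`, `x₀ = 0`, `s g` = the fired-and-live pattern of cut `g` on the class, `φ = 𝟙_{w'}`; the left side is
`#class_{w'} − 2·#win_{w'}` restricted to `x_n = w'`.) -/

/-- The sign `±1` of a pattern at a point. -/
noncomputable def sgn {N : ℕ} (D : ZMod N → Bool) (x : ZMod N) : ℝ := if D x then -1 else 1

/-- Auxiliary step `signFlip_apply_eq` of rung (G) (planner qa-qnc0-p2, `RungGCore.lean` v3, verbatim). -/
theorem signFlip_apply_eq {N : ℕ} (D : ZMod N → Bool) (v : ZMod N → ℝ) (x : ZMod N) : signFlip D v x = sgn D x * v x := by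
  unfold signFlip sgn
  split_ifs <;> ring

/-- Auxiliary step `sgn_mul_self` of rung (G) (planner qa-qnc0-p2, `RungGCore.lean` v3, verbatim). -/
theorem sgn_mul_self {N : ℕ} (D : ZMod N → Bool) (x : ZMod N) : sgn D x * sgn D x = 1 := by
  unfold sgn; split_ifs <;> norm_num

/-- Auxiliary step `sgn_eq_one_sub` of rung (G) (planner qa-qnc0-p2, `RungGCore.lean` v3, verbatim). -/
theorem sgn_eq_one_sub {N : ℕ} (D : ZMod N → Bool) (x : ZMod N) : sgn D x = 1 - 2 * (if D x then 1 else 0) := by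
  unfold sgn; split_ifs <;> norm_num

/-- Auxiliary step `wt_zero_rg` of rung (G) (planner qa-qnc0-p2, `RungGCore.lean` v3, verbatim). -/
theorem wt_zero_rg (u : Fin 0 → Bool) : wt u = 0 := by
  simp [wt]

/-- **Transfer identity** (sum over the cube = `2^n ×` operator product). -/
theorem transfer {M : ℕ} : ∀ (n : ℕ) (s : Fin (n + 1) → ZMod (M + 1) → Bool) (φ : ZMod (M + 1) → ℝ) (x₀ : ZMod (M + 1)),
    ∑ u : Fin n → Bool, (∏ g : Fin (n + 1), sgn (s g) (x₀ + ((wtPrefix u g.val : ℕ) : ZMod (M + 1)))) *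
        φ (x₀ + ((wt u : ℕ) : ZMod (M + 1)))
      = 2 ^ n * prodOp (List.ofFn fun i : Fin n => s (Fin.castSucc i)) (signFlip (s (Fin.last n)) φ) x₀
  | 0, s, φ, x₀ => by
      rw [Fintype.sum_unique, Fin.prod_univ_succ, Fin.prod_univ_zero]
      simp only [Fin.val_zero, wtPrefix_zero, wt_zero_rg, Nat.cast_zero, add_zero, pow_zero, one_mul, mul_one,
        List.ofFn_zero, prodOp_nil, signFlip_apply_eq, Fin.last_zero]
  | n + 1, s, φ, x₀ => by
      -- split `u = b :: u'`
      rw [← Fintype.sum_equiv (Fin.consEquiv fun _ => Bool)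
        (fun q => (∏ g : Fin (n + 2), sgn (s g) (x₀ + ((wtPrefix (Fin.cons q.1 q.2 : Fin (n + 1) → Bool) g.val : ℕ) : ZMod (M + 1)))) *
          φ (x₀ + ((wt (Fin.cons q.1 q.2 : Fin (n + 1) → Bool) : ℕ) : ZMod (M + 1))))
        _ (fun q => rfl)]
      rw [Fintype.sum_prod_type, Fintype.sum_bool]
      -- rewrite the products: cut `0` contributes `sgn (s 0) x₀`, cut `i.succ` sees `b + wtPrefix u' i`
      have hprod : ∀ (b : Bool) (u' : Fin n → Bool),
          (∏ g : Fin (n + 2), sgn (s g) (x₀ + ((wtPrefix (Fin.cons b u' : Fin (n + 1) → Bool) g.val : ℕ) : ZMod (M + 1)))) =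
            sgn (s 0) x₀ * ∏ i : Fin (n + 1), sgn (s i.succ) ((x₀ + ((b.toNat : ℕ) : ZMod (M + 1))) +
              ((wtPrefix u' i.val : ℕ) : ZMod (M + 1))) := by
        intro b u'
        rw [Fin.prod_univ_succ]
        simp only [Fin.val_zero, wtPrefix_zero, Nat.cast_zero, add_zero, Fin.val_succ, wtPrefix_cons_succ, Nat.cast_add,
          add_assoc]
      have hwt : ∀ (b : Bool) (u' : Fin n → Bool),
          φ (x₀ + ((wt (Fin.cons b u' : Fin (n + 1) → Bool) : ℕ) : ZMod (M + 1))) =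
            φ ((x₀ + ((b.toNat : ℕ) : ZMod (M + 1))) + ((wt u' : ℕ) : ZMod (M + 1))) := by
        intro b u'
        rw [wt_cons, Nat.cast_add, add_assoc]
      simp only [hprod, hwt]
      -- pull out `sgn (s 0) x₀` and apply the induction hypothesis at `x₀ + 1` and `x₀`
      have ih := fun x => transfer n (fun i => s i.succ) φ x
      simp only [mul_assoc, ← Finset.mul_sum]
      rw [show ((true.toNat : ℕ) : ZMod (M + 1)) = 1 by simp, show ((false.toNat : ℕ) : ZMod (M + 1)) = 0 by simp, add_zero]
      rw [ih (x₀ + 1), ih x₀]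
      -- identify the lists and the last pattern
      have hlist : (List.ofFn fun i : Fin (n + 1) => s (Fin.castSucc i)) =
          s 0 :: List.ofFn fun i : Fin n => s (Fin.castSucc i).succ := by
        rw [List.ofFn_succ]
        congr 1
      have hlast : s (Fin.last (n + 1)) = s (Fin.last n).succ := by rw [Fin.succ_last]
      rw [hlist, prodOp_cons, signFlip_apply_eq, hlast]
      simp only [lazyStep]
      ring


end RungG

end Coset21

end Summit.QuantumAdvantage.AdviceFreeQNC0
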